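import Summits.AtomisticToContinuum.HydrodynamicLimit.Theorems.LambertianContactSwapLambertianEulerEstimateOfHearts
import HarnessLib

/-!
# Statics of the Lambertian entropy clock are time-Lipschitz, uniformly in `N`
# (tool `StaticsLipschitz` of line `Sketch`, crux stmt-AtomisticToContinuum-11854, lead c8)

Support file (`--supports stmt-AtomisticToContinuum-11854`).  The statics term of the collisional heart of the
line is `dLZ σ Rf ρ N s s′ = log Zpos(a_{s′}) − log Zpos(a_s)` (`…LambertianEulerHearts.dLZ`), the increment of
the logarithm of the configurational partition function `Zpos(a) = ∫ 𝟙_{no overlap}(x) ∏ᵢ a(xᵢ) dx` of `N + 1`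
hard spheres at reduced diameter `σ` (`posPartition`) along the explicit reference activity
`a_r = ρ_r · Rf(σ³ρ_r)` of a classical hs-Euler solution.  On sub-intervals shorter than the minimal window the
lead bounds it trivially, which needs `|dLZ(s, s′)| ≤ C (s′ − s) (N + 1)` with `C` INDEPENDENT of `N`.  The
cheap route (no Gibbs moments):

* S1 `abs_log_posPartition_sub_le_of_forall` — the SHARP sandwich of configurational partition functions
  over the SAME non-overlap set: `|log b − log a| ≤ δ` pointwise gives `∏ b(xᵢ) ≤ e^{δ(N+1)} ∏ a(xᵢ)` on the
  non-overlap set, so `Z_b ≤ e^{δ(N+1)} Z_a` and symmetrically, `|log Z_b − log Z_a| ≤ δ (N + 1)`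
  (`posWeight_le_exp_pow_mul_posWeight`, `posPartition_le_exp_pow_mul_posPartition`, `log_posPartition_sub_le_mul`;
  sharp form of `Theorems.exists_abs_log_posPartition_sub_le`, whose constant is `log (sup/inf)`);
* S2 `exists_abs_log_sub_log_le_mul_of_smooth` — a jointly smooth positive space–time profile `A` on
  `[0, T) × 𝕋³` has `log A` time-Lipschitz on `[0, t] × 𝕋³`, `t < T`, uniformly in space: `log A` is jointly
  smooth (`ContDiffOn.log` on the space–time lift), its one-sided time derivative is jointly smooth
  (`IsSmoothSpaceTimeOn.timeDerivWithin`) hence bounded on the compact `[0, t] × 𝕋³`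
  (`IsSmoothSpaceTimeOn.exists_norm_le_of_isCompact`), and the mean value inequality
  (`Convex.norm_image_sub_le_of_norm_hasDerivWithin_le` with `IsSmoothSpaceTimeOn.hasDerivWithinAt_slice`)
  concludes;
* S3 `abs_dLZ_le_of_smooth` — S1 with `δ := C_A (s′ − s)` from S2 applied to `A := ρ · Rf(σ³ρ)`:
  `|dLZ σ Rf ρ N s s′| ≤ C_A (s′ − s) (N + 1)` for `0 ≤ s ≤ s′ ≤ t`, given the joint smoothness and positivity
  of the activity on `[0, T)`; and the MAIN form `abs_dLZ_le` in the frame of the hearts (insertion factor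
  `(r, Rf, hr, hsol, hbd, hcont, huniq)`, then a packing band `ηh > 0` OF THE TOOL'S CHOOSING — the band of the
  analytic insertion factor, `…EstimateOfHearts.isSmoothSpaceTimeOn_activityRf`, inside which `ρ · Rf(σ³ρ)` is
  jointly smooth and positive — then `0 < σ < 1/2`, the Euler solution with packing `< ηh`, and `t ∈ (0, T)`).
  Why a band of the tool's choosing and not `r/2`: the handed-over clauses on `Rf` (root of the insertion equation,
  `1 ≤ Rf ≤ 2`, continuity, uniqueness of the root in `[1/2, 2]`) do not make `Rf` Lipschitz on all of `[0, r/2]`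
  (the insertion equation may degenerate away from `0`); smoothness of `Rf` is only known on the radius of the
  tree's analytic insertion factor, with which `Rf` agrees by uniqueness — exactly the band of the hearts' frame.

No measure theory beyond monotonicity of the Bochner integral; no definitions.  All [folklore]
(Spohn 1991 Part I §2.1: the configurational partition function; the rest is calculus).
-/

noncomputable section

open scoped BigOperators Topology ContDiff
open MeasureTheory Filter Set
open Literature.MathematicalPhysics.KineticTheory
open Literature.Analysis.FluidPDE
open Literature.Analysis.FunctionSpaces

namespace Summit.AtomisticToContinuum.HydrodynamicLimit.Theorems.LambertianContactSwapLambertianEulerStaticsLipschitz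

open Summit.AtomisticToContinuum.HydrodynamicLimit.Theorems.LambertianContactSwapLambertianEulerHearts
open Summit.AtomisticToContinuum.HydrodynamicLimit.Theorems.LambertianContactSwapLambertianEulerEstimateOfHearts

/-! ## S1. The sharp sandwich of configurational partition functions -/

/-- Pointwise comparison of position weights over the same non-overlap set: if `0 ≤ b ≤ e^δ · a` pointwise
then `𝟙_{no overlap} ∏ᵢ b(xᵢ) ≤ (e^δ)^n · 𝟙_{no overlap} ∏ᵢ a(xᵢ)`. [folklore] -/
theorem posWeight_le_exp_pow_mul_posWeight {a b : T3 → ℝ} (hb0 : ∀ x, 0 ≤ b x) {δ : ℝ}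
    (hab : ∀ x, b x ≤ Real.exp δ * a x) (ε : ℝ) {n : ℕ} (x : Fin n → T3) :
    posWeight b ε n x ≤ Real.exp δ ^ n * posWeight a ε n x := by
  unfold posWeight
  by_cases hx : x ∈ posDomain ε n
  · rw [Set.indicator_of_mem hx, Set.indicator_of_mem hx]
    calc ∏ i, b (x i) ≤ ∏ i, (Real.exp δ * a (x i)) :=
          Finset.prod_le_prod (fun i _ => hb0 _) fun i _ => hab _
      _ = Real.exp δ ^ n * ∏ i, a (x i) := by
          rw [Finset.prod_mul_distrib, Finset.prod_const, Finset.card_univ, Fintype.card_fin]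
  · rw [Set.indicator_of_notMem hx, Set.indicator_of_notMem hx, mul_zero]

/-- Comparison of configurational partition functions over the same non-overlap set: if `0 ≤ b ≤ e^δ · a`
pointwise (`a ≥ 0`, both continuous) then `Z_b ≤ (e^δ)^n · Z_a`. [folklore] -/
theorem posPartition_le_exp_pow_mul_posPartition {a b : T3 → ℝ} (ha : Continuous a) (hb : Continuous b)
    (ha0 : ∀ x, 0 ≤ a x) (hb0 : ∀ x, 0 ≤ b x) {δ : ℝ} (hab : ∀ x, b x ≤ Real.exp δ * a x) (ε : ℝ) (n : ℕ) :
    posPartition b ε n ≤ Real.exp δ ^ n * posPartition a ε n := by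
  rw [posPartition, posPartition, ← integral_const_mul]
  exact integral_mono (integrable_posWeight hb hb0 _ _) ((integrable_posWeight ha ha0 _ _).const_mul _)
    fun x => posWeight_le_exp_pow_mul_posWeight hb0 hab ε x

/-- One-sided sharp comparison of the logarithms: `log b − log a ≤ δ` pointwise (continuous `a, b > 0`) gives
`log Z_b − log Z_a ≤ δ · (N + 1)` at reduced diameter `σ ≤ 1/2` (both partition functions are positive:
`posPartition_pos`). [folklore] -/
theorem log_posPartition_sub_le_mul {a b : T3 → ℝ} (ha : Continuous a) (hb : Continuous b)
    (ha0 : ∀ x, 0 < a x) (hb0 : ∀ x, 0 < b x) {δ : ℝ} (hab : ∀ x, Real.log (b x) - Real.log (a x) ≤ δ)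
    {σ : ℝ} (hσ2 : σ ≤ 1 / 2) (N : ℕ) :
    Real.log (posPartition b (hsDiameter σ N) (N + 1)) - Real.log (posPartition a (hsDiameter σ N) (N + 1)) ≤
      δ * ((N : ℝ) + 1) := by
  have hpt : ∀ x, b x ≤ Real.exp δ * a x := by
    intro x
    have h := hab x
    calc b x = Real.exp (Real.log (b x)) := (Real.exp_log (hb0 x)).symm
      _ ≤ Real.exp (δ + Real.log (a x)) := Real.exp_le_exp.2 (by linarith)
      _ = Real.exp δ * a x := by rw [Real.exp_add, Real.exp_log (ha0 x)]
  have hZa := posPartition_pos ha ha0 hσ2 N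
  have hZb := posPartition_pos hb hb0 hσ2 N
  have hle := posPartition_le_exp_pow_mul_posPartition ha hb (fun x => (ha0 x).le) (fun x => (hb0 x).le) hpt
    (hsDiameter σ N) (N + 1)
  have hlog := Real.log_le_log hZb hle
  rw [Real.log_mul (pow_pos (Real.exp_pos δ) _).ne' hZa.ne', Real.log_pow, Real.log_exp] at hlog
  push_cast at hlog
  linarith

/-- **S1. Sharp two-sided comparison of configurational partition functions** (registered sub-goal of
stmt-11854): for continuous activities `a, b > 0` on `𝕋³` with `|log b − log a| ≤ δ` pointwise,
`|log Z_b − log Z_a| ≤ δ · (N + 1)` for every `N` at reduced diameter `0 < σ ≤ 1/2` — both partition functions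
are integrals of `∏ activity` over the SAME non-overlap set, on which `∏ b(xᵢ) ≤ e^{δ(N+1)} ∏ a(xᵢ)` and
symmetrically. [folklore] -/
theorem abs_log_posPartition_sub_le_of_forall : ∀ {a b : T3 → ℝ}, Continuous a → Continuous b →
    (∀ x, 0 < a x) → (∀ x, 0 < b x) → ∀ {δ : ℝ}, 0 ≤ δ → (∀ x, |Real.log (b x) - Real.log (a x)| ≤ δ) →
    ∀ {σ : ℝ}, 0 < σ → σ ≤ 1 / 2 → ∀ N : ℕ,
    |Real.log (posPartition b (hsDiameter σ N) (N + 1)) - Real.log (posPartition a (hsDiameter σ N) (N + 1))| ≤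
      δ * ((N : ℝ) + 1) := by
  intro a b ha hb ha0 hb0 δ _ hab σ _ hσ2 N
  rw [abs_le]
  refine ⟨?_, log_posPartition_sub_le_mul ha hb ha0 hb0 (fun x => (le_abs_self _).trans (hab x)) hσ2 N⟩
  have h := log_posPartition_sub_le_mul hb ha hb0 ha0 (δ := δ) (fun x => ?_) hσ2 N
  · linarith
  · have h' := hab x
    rw [abs_le] at h'
    linarith

/-! ## S2. Logarithms of jointly smooth positive profiles are time-Lipschitz, uniformly in space -/

/-- **S2. Time-Lipschitz bound of `log A` on `[0, t] × 𝕋³`** (registered sub-goal of stmt-11854): for a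
space–time profile `A` jointly smooth on `[0, T) × 𝕋³` and positive there, and `0 < t < T`, there is `C ≥ 0` with
`|log A(s′, x) − log A(s, x)| ≤ C |s′ − s|` for all `s, s′ ∈ [0, t]` and all `x` (`log A` is jointly smooth, its
one-sided time derivative is jointly smooth hence bounded on the compact `[0, t] × 𝕋³`, mean value inequality in
time at fixed `x`). [folklore] -/
theorem exists_abs_log_sub_log_le_mul_of_smooth : ∀ {T : ℝ} {A : ℝ → T3 → ℝ},
    Torus.IsSmoothSpaceTimeOn (Set.Ico 0 T) A → (∀ r ∈ Set.Ico 0 T, ∀ x, 0 < A r x) →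
    ∀ {t : ℝ}, 0 < t → t < T →
    ∃ C : ℝ, 0 ≤ C ∧ ∀ s ∈ Set.Icc 0 t, ∀ s' ∈ Set.Icc 0 t, ∀ x : T3,
      |Real.log (A s' x) - Real.log (A s x)| ≤ C * |s' - s| := by
  intro T A hA hpos t ht htT
  -- `log A` is jointly smooth on `[0, T) × 𝕋³`
  have hL : Torus.IsSmoothSpaceTimeOn (Set.Ico 0 T) (fun r x => Real.log (A r x)) := by
    show ContDiffOn ℝ _ (fun p => Real.log (Torus.stLift A p)) _
    exact ContDiffOn.log hA fun p hp => (hpos p.1 (Set.mem_prod.1 hp).1 _).ne'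
  have hU : UniqueDiffOn ℝ (Set.Ico (0 : ℝ) T) := uniqueDiffOn_Ico 0 T
  -- its one-sided time derivative is jointly smooth, hence bounded on `[0, t] × 𝕋³`
  have hD := hL.timeDerivWithin hU
  have hKS : Set.Icc 0 t ⊆ Set.Ico 0 T := fun r hr => ⟨hr.1, hr.2.trans_lt htT⟩
  obtain ⟨C, hC⟩ := hD.exists_norm_le_of_isCompact isCompact_Icc hKS
  have hC0 : 0 ≤ C := (norm_nonneg _).trans (hC 0 ⟨le_rfl, ht.le⟩ 0)
  refine ⟨C, hC0, fun s hs s' hs' x => ?_⟩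
  -- mean value inequality in time at fixed `x`
  have hderiv : ∀ r ∈ Set.Icc 0 t, HasDerivWithinAt (fun τ => Real.log (A τ x))
      (Torus.timeDerivWithin (Set.Ico 0 T) (fun r x => Real.log (A r x)) r x) (Set.Icc 0 t) r :=
    fun r hr => (hL.hasDerivWithinAt_slice (hKS hr) x).mono hKS
  have h := (convex_Icc 0 t).norm_image_sub_le_of_norm_hasDerivWithin_le
    (f := fun τ => Real.log (A τ x))
    (f' := fun r => Torus.timeDerivWithin (Set.Ico 0 T) (fun r x => Real.log (A r x)) r x)
    hderiv (fun r hr => hC r hr x) hs hs'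
  rw [Real.norm_eq_abs, Real.norm_eq_abs] at h
  exact h

/-! ## S3. The statics `dLZ` are time-Lipschitz, uniformly in `N` -/

/-- **S3 (smooth-activity form). `|dLZ σ Rf ρ N s s′| ≤ C (s′ − s) (N + 1)` with `C` independent of `N`**,
for `0 ≤ s ≤ s′ ≤ t < T`, whenever the activity `(r, x) ↦ ρ_r(x) · Rf(σ³ρ_r(x))` is jointly smooth and positive on
`[0, T) × 𝕋³` and `0 < σ < 1/2`: S1 with `δ := C_A (s′ − s)`, `C_A` the time-Lipschitz constant of the log-activity
on `[0, t] × 𝕋³` from S2. [folklore] -/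
theorem abs_dLZ_le_of_smooth : ∀ {σ : ℝ}, 0 < σ → σ < 2⁻¹ → ∀ {T : ℝ} {Rf : ℝ → ℝ} {ρ : ℝ → T3 → ℝ},
    Torus.IsSmoothSpaceTimeOn (Set.Ico 0 T) (fun r x => ρ r x * Rf (σ ^ 3 * ρ r x)) →
    (∀ r ∈ Set.Ico 0 T, ∀ x, 0 < ρ r x * Rf (σ ^ 3 * ρ r x)) →
    ∀ t : ℝ, 0 < t → t < T → ∃ C : ℝ, 0 ≤ C ∧ ∀ (N : ℕ) (s s' : ℝ), 0 ≤ s → s ≤ s' → s' ≤ t →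
      |dLZ σ Rf ρ N s s'| ≤ C * (s' - s) * ((N : ℝ) + 1) := by
  intro σ hσ hσi T Rf ρ hsm hpos t ht htT
  obtain ⟨C, hC0, hC⟩ := exists_abs_log_sub_log_le_mul_of_smooth hsm hpos ht htT
  refine ⟨C, hC0, fun N s s' hs hss' hs't => ?_⟩
  have hsI : s ∈ Set.Icc 0 t := ⟨hs, hss'.trans hs't⟩
  have hs'I : s' ∈ Set.Icc 0 t := ⟨hs.trans hss', hs't⟩
  have hσ2 : σ ≤ 1 / 2 := by rw [one_div]; exact hσi.le
  have hcont : ∀ r ∈ Set.Icc 0 t, Continuous fun x => ρ r x * Rf (σ ^ 3 * ρ r x) := fun r hr =>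
    (hsm.isSmooth_slice ⟨hr.1, hr.2.trans_lt htT⟩).continuous
  have hposr : ∀ r ∈ Set.Icc 0 t, ∀ x, 0 < ρ r x * Rf (σ ^ 3 * ρ r x) := fun r hr =>
    hpos r ⟨hr.1, hr.2.trans_lt htT⟩
  have hδ : ∀ x, |Real.log (ρ s' x * Rf (σ ^ 3 * ρ s' x)) - Real.log (ρ s x * Rf (σ ^ 3 * ρ s x))| ≤
      C * (s' - s) := by
    intro x
    have h := hC s hsI s' hs'I x
    rwa [abs_of_nonneg (sub_nonneg.2 hss')] at h
  have h := abs_log_posPartition_sub_le_of_forall (hcont s hsI) (hcont s' hs'I) (hposr s hsI) (hposr s' hs'I)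
    (mul_nonneg hC0 (sub_nonneg.2 hss')) hδ hσ hσ2 N
  unfold dLZ
  exact h

/-- **S3 (MAIN; registered sub-goal of stmt-11854). The statics of the Lambertian entropy clock are
time-Lipschitz, uniformly in `N`**, in the frame of the hearts: for every insertion factor `(r, Rf)` (positive root
of the insertion equation on `(−r, r)`, `1 ≤ Rf ≤ 2` and continuous on `[0, r]`, unique root in `[1/2, 2]`) there
is a packing band `ηh > 0` (that of the analytic insertion factor, `isSmoothSpaceTimeOn_activityRf`, inside which
the explicit activity `ρ · Rf(σ³ρ)` is jointly smooth and positive) such that for `0 < σ < 1/2`, every classical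
hs-Euler solution on `[0, T)` with packing `ρσ³ < ηh` and every `t ∈ (0, T)` there is `C ≥ 0` with
`|dLZ σ Rf ρ N s s′| ≤ C (s′ − s) (N + 1)` for ALL `N` and all `0 ≤ s ≤ s′ ≤ t`. [folklore] -/
theorem abs_dLZ_le : ∀ (r : ℝ) (Rf : ℝ → ℝ), 0 < r →
      (∀ x ∈ Set.Ioo (-r) r, 0 < Rf x ∧ Rf x * (∑' j : ℕ, bE j / (j.factorial : ℝ) * (x * Rf x) ^ j) = 1) →
      (∀ x ∈ Set.Icc 0 r, 1 ≤ Rf x ∧ Rf x ≤ 2) → ContinuousOn Rf (Set.Icc 0 r) →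
      (∀ x ∈ Set.Ioo (-r) r, ∀ R ∈ Set.Icc (1 / 2 : ℝ) 2,
        R * (∑' j : ℕ, bE j / (j.factorial : ℝ) * (x * R) ^ j) = 1 → R = Rf x) →
    ∃ ηh : ℝ, 0 < ηh ∧ ∀ {σ : ℝ}, 0 < σ → σ < 2⁻¹ →
      ∀ (T : ℝ) (ρ θ : ℝ → T3 → ℝ) (u : ℝ → T3 → V3), IsHardSphereEulerSolution σ T ρ u θ →
        (∀ t ∈ Set.Ico 0 T, ∀ x, ρ t x * σ ^ 3 < ηh) →
        ∀ t : ℝ, 0 < t → t < T → ∃ C : ℝ, 0 ≤ C ∧ ∀ (N : ℕ) (s s' : ℝ), 0 ≤ s → s ≤ s' → s' ≤ t →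
          |dLZ σ Rf ρ N s s'| ≤ C * (s' - s) * ((N : ℝ) + 1) := by
  intro r Rf hr hsol _ _ huniq
  obtain ⟨η, hη, hηr, Hsm⟩ := isSmoothSpaceTimeOn_activityRf hr huniq
  refine ⟨η, hη, fun {σ} hσ hσi T ρ θ u hE hband t ht htT => ?_⟩
  have hσ3pos : 0 < σ ^ 3 := by positivity
  have hbandF : ∀ t' ∈ Set.Ico 0 T, ∀ x, 0 < σ ^ 3 * ρ t' x ∧ σ ^ 3 * ρ t' x < η := fun t' ht' x =>
    ⟨mul_pos hσ3pos (hE.density_pos t' ht' x), by rw [mul_comm]; exact hband t' ht' x⟩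
  have hsmooth : Torus.IsSmoothSpaceTimeOn (Set.Ico 0 T) (fun r' x => ρ r' x * Rf (σ ^ 3 * ρ r' x)) :=
    Hsm hE.smooth_density hbandF
  have hapos : ∀ t' ∈ Set.Ico 0 T, ∀ x, 0 < ρ t' x * Rf (σ ^ 3 * ρ t' x) := fun t' ht' x =>
    mul_pos (hE.density_pos t' ht' x)
      (hsol _ ⟨by linarith [(hbandF t' ht' x).1], (hbandF t' ht' x).2.trans_le hηr⟩).1
  exact abs_dLZ_le_of_smooth hσ hσi hsmooth hapos t ht htT

end Summit.AtomisticToContinuum.HydrodynamicLimit.Theorems.LambertianContactSwapLambertianEulerStaticsLipschitz
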